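import Summits.Parity.GeneralizedHardyLittlewood.Theses.LiouvilleShiftedTables
import Summits.Parity.GeneralizedHardyLittlewood.Theorems.TableChowla.Negative.TableChowlaOperatorNorm

/-!
# `TableChowla` (stmt-Parity-14270): the picked line's residual WITHOUT the words "completely
# multiplicative" is already the crux — `MeanSquareBounded ↔ TableChowla`

Structural lemma for the crux `LiouvilleShiftedTables.TableChowla` (cdisprove seat, gen 3), on the
line `helson-kronecker-inverse` (`Cruxes/TableChowla/Lines/helson-kronecker-inverse.lean`). Its residual
`MeanSquareCM` bounds `Σ_{a∼A} ‖Σ_{b≤y} g(b) λ(ab+c)‖²` by `x·(x/A)/(log x)^C` for every COMPLETELY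
MULTIPLICATIVE 1-bounded weight `g`. Delete "completely multiplicative": the resulting statement
`MeanSquareBounded` (all 1-bounded `g : ℕ → ℂ`) is EQUIVALENT to the crux (`meanSquareBounded_iff`):

* `tableChowla_of_meanSquareBounded`: test the table against ITS OWN ROWS — with `g = λ(a·+c)` (row `a`,
  `±1`-valued, not multiplicative in `b`) the mean square over `a'` is `Σ_{a'} S(a,a')²`, and summing over
  the `≤ 2A` rows gives `T ≤ 2A · x(x/A)/(log x)^{C+1} ≤ x²/(log x)^C`;
* `meanSquareBounded_of_tableChowla`: `‖M g‖² ≤ ‖g‖²·√T` (real and imaginary parts through the landed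
  `rowform_sq_le`), `‖g‖² ≤ y ≤ x/A`, `√T ≤ x/(log x)^C` from the crux at level `2C`.

So the ENTIRE content of the line is the claim that completely multiplicative weights are extremal (up to
log powers) among bounded weights for this table — its lever `InverseCM` — while the table's own rows, the
witnesses of extremality in general, are as far from multiplicative as `λ(ab+c)` is from `u(a)v(b)`.
(Companion findings: `TableChowlaAperiodicVacuity` — the `K`-aperiodicity proviso is void;
`TableChowlaOperatorNorm` — the `ℓ²` operator-norm form is the crux.) [folklore]
-/

namespace Summit.Parity.GeneralizedHardyLittlewood.Theorems.TableChowla.Negative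

open Finset Real ArithmeticFunction
open Summit.Parity.GeneralizedHardyLittlewood.Theses

noncomputable section

/-- The line's residual with the multiplicativity clause deleted: mean-square dispersion of the table
against EVERY 1-bounded complex column weight. -/
def MeanSquareBounded : Prop :=
  ∀ c : ℤ, c ≠ 0 → ∀ δ : ℝ, 0 < δ → δ ≤ 1 / 12 → ∀ C : ℝ, 0 < C → ∃ x₀ : ℝ, ∀ x : ℝ, x₀ ≤ x →
    ∀ A : ℝ, x ^ δ ≤ A → A ≤ x ^ (1 / 3 + δ) →
    ∀ g : ℕ → ℂ, (∀ n : ℕ, ‖g n‖ ≤ 1) →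
    ∀ y : ℝ, y ≤ x / A →
      ∑ a ∈ Finset.Ioc ⌊A⌋₊ ⌊2 * A⌋₊,
          ‖∑ b ∈ Finset.Icc 1 ⌊y⌋₊, g b * (entry c a b : ℂ)‖ ^ 2 ≤
        x * (x / A) / Real.log x ^ C

/-- `‖Σ g_b e_b‖² = (Σ Re g_b · e_b)² + (Σ Im g_b · e_b)²` for real `e`. -/
theorem norm_sq_sum_mul_ofReal (g : ℕ → ℂ) (e : ℕ → ℝ) (S : Finset ℕ) :
    ‖∑ b ∈ S, g b * (e b : ℂ)‖ ^ 2 =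
      (∑ b ∈ S, (g b).re * e b) ^ 2 + (∑ b ∈ S, (g b).im * e b) ^ 2 := by
  rw [Complex.sq_norm, Complex.normSq_apply, Complex.re_sum, Complex.im_sum]
  have hre : ∀ b, (g b * (e b : ℂ)).re = (g b).re * e b := fun b => by simp
  have him : ∀ b, (g b * (e b : ℂ)).im = (g b).im * e b := fun b => by simp
  simp_rw [hre, him]
  ring

/-- Testing against a ROW: with `g = row a` the mean square over `a'` is `Σ_{a'} S(a,a')²`. -/
theorem norm_sq_row_weight (c : ℤ) (B a a' : ℕ) :
    ‖∑ b ∈ Icc 1 B, (entry c a b : ℂ) * (entry c a' b : ℂ)‖ ^ 2 = rowCorr lam c B a a' ^ 2 := by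
  have : ∑ b ∈ Icc 1 B, (entry c a b : ℂ) * (entry c a' b : ℂ) = ((rowCorr lam c B a a' : ℝ) : ℂ) := by
    unfold rowCorr
    push_cast
    rfl
  rw [this, Complex.norm_real, Real.norm_eq_abs, sq_abs]

/-- The number of rows is at most `2A`. -/
theorem rows_le_two_mul {A : ℝ} (hA : 0 ≤ A) : ((⌊2 * A⌋₊ - ⌊A⌋₊ : ℕ) : ℝ) ≤ 2 * A :=
  le_trans (by exact_mod_cast Nat.sub_le _ _) (Nat.floor_le (by positivity))

/-- `MeanSquareBounded → TableChowla`: sum the residual over the table's own rows. -/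
theorem tableChowla_of_meanSquareBounded (h : MeanSquareBounded) : LiouvilleShiftedTables.TableChowla := by
  rw [tableChowla_iff]
  intro c hc δ hδ hδ' C hC
  obtain ⟨x₀, hx₀⟩ := h c hc δ hδ hδ' (C + 1) (by linarith)
  obtain ⟨X, hX⟩ := eventually_log_rpow_le hδ C
  refine ⟨max (max x₀ X) 1, fun x hx A hA hA' => ?_⟩
  have hx₀' : x₀ ≤ x := le_trans (le_trans (le_max_left _ _) (le_max_left _ _)) hx
  have hxX : X ≤ x := le_trans (le_trans (le_max_right _ _) (le_max_left _ _)) hx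
  have hx1 : (1 : ℝ) ≤ x := le_trans (le_max_right _ _) hx
  have hxpos : (0 : ℝ) < x := by linarith
  have hApos : 0 < A := lt_of_lt_of_le (Real.rpow_pos_of_pos hxpos δ) hA
  have hlog2 : 2 ≤ Real.log x := (hX x hxX).2
  have hLpos : 0 < Real.log x := by linarith
  set L : ℝ := Real.log x with hL
  -- each row as a test weight
  have hrow : ∀ a ∈ Ioc ⌊A⌋₊ ⌊2 * A⌋₊,
      ∑ a' ∈ Ioc ⌊A⌋₊ ⌊2 * A⌋₊, rowCorr lam c ⌊x / A⌋₊ a a' ^ 2 ≤ x * (x / A) / L ^ (C + 1) := by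
    intro a _
    have hg : ∀ n : ℕ, ‖((entry c a n : ℝ) : ℂ)‖ ≤ 1 := fun n => by
      rw [Complex.norm_real, Real.norm_eq_abs, entry_eq]; exact abs_lam_le_one _
    have key := hx₀ x hx₀' A hA hA' (fun b => (entry c a b : ℂ)) hg (x / A) le_rfl
    simp_rw [norm_sq_row_weight] at key
    exact key
  show momentN lam c ⌊A⌋₊ ⌊2 * A⌋₊ ⌊x / A⌋₊ ≤ x ^ 2 / Real.log x ^ C
  unfold momentN
  calc ∑ a ∈ Ioc ⌊A⌋₊ ⌊2 * A⌋₊, ∑ a' ∈ Ioc ⌊A⌋₊ ⌊2 * A⌋₊, rowCorr lam c ⌊x / A⌋₊ a a' ^ 2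
      ≤ ∑ _a ∈ Ioc ⌊A⌋₊ ⌊2 * A⌋₊, x * (x / A) / L ^ (C + 1) := sum_le_sum hrow
    _ = ((⌊2 * A⌋₊ - ⌊A⌋₊ : ℕ) : ℝ) * (x * (x / A) / L ^ (C + 1)) := by
        rw [sum_const, Nat.card_Ioc, nsmul_eq_mul]
    _ ≤ (2 * A) * (x * (x / A) / L ^ (C + 1)) := by
        refine mul_le_mul_of_nonneg_right (rows_le_two_mul hApos.le) ?_
        exact div_nonneg (by positivity) (Real.rpow_nonneg hLpos.le _)
    _ = 2 * x ^ 2 / (L ^ C * L) := by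
        rw [Real.rpow_add_one hLpos.ne' C]
        field_simp
    _ ≤ x ^ 2 / L ^ C := by
        have hLC : 0 < L ^ C := Real.rpow_pos_of_pos hLpos C
        rw [div_le_div_iff₀ (by positivity) hLC]
        nlinarith [mul_nonneg (sq_nonneg x) hLC.le, mul_pos hLC hLC]

/-- `TableChowla → MeanSquareBounded`: `‖M g‖² ≤ ‖g‖² √T ≤ (x/A) · x/(log x)^C` (crux at level `2C`;
real and imaginary parts of `g`, zero-extended from `[1,⌊y⌋]` to all columns, through `rowform_sq_le`). -/
theorem meanSquareBounded_of_tableChowla (h : LiouvilleShiftedTables.TableChowla) : MeanSquareBounded := by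
  intro c hc δ hδ hδ' C hC
  obtain ⟨x₀, hx₀⟩ := (tableChowla_iff.mp h) c hc δ hδ hδ' (2 * C) (by linarith)
  refine ⟨max x₀ 1, fun x hx A hA hA' g hg y hy => ?_⟩
  have hx₀' : x₀ ≤ x := le_trans (le_max_left _ _) hx
  have hx1 : (1 : ℝ) ≤ x := le_trans (le_max_right _ _) hx
  have hx0 : (0 : ℝ) ≤ x := by linarith
  have hxpos : (0 : ℝ) < x := by linarith
  have hApos : 0 < A := lt_of_lt_of_le (Real.rpow_pos_of_pos hxpos δ) hA
  have hL0 : 0 ≤ Real.log x := Real.log_nonneg hx1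
  set B : ℕ := ⌊x / A⌋₊ with hB
  set N : ℕ := ⌊y⌋₊ with hN
  have hNB : N ≤ B := Nat.floor_mono hy
  have hT : momentN lam c ⌊A⌋₊ ⌊2 * A⌋₊ B ≤ x ^ 2 / Real.log x ^ (2 * C) := hx₀ x hx₀' A hA hA'
  -- zero-extended real and imaginary weights
  set wr : ℕ → ℝ := fun b => if b ≤ N then (g b).re else 0 with hwr
  set wi : ℕ → ℝ := fun b => if b ≤ N then (g b).im else 0 with hwi
  have hfilter : (Icc 1 B).filter (fun b => b ≤ N) = Icc 1 N := by
    ext b; simp only [mem_filter, mem_Icc]; omega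
  have hsum_ext : ∀ (w : ℕ → ℝ) (a : ℕ),
      ∑ b ∈ Icc 1 B, (if b ≤ N then w b else 0) * lam (Int.toNat ((a : ℤ) * b + c)) =
        ∑ b ∈ Icc 1 N, w b * entry c a b := by
    intro w a
    rw [← hfilter, sum_filter]
    refine sum_congr rfl fun b _ => ?_
    split_ifs <;> simp [entry_eq]
  have hsq_ext : ∀ (w : ℕ → ℝ), ∑ b ∈ Icc 1 B, (if b ≤ N then w b else 0) ^ 2 =
      ∑ b ∈ Icc 1 N, w b ^ 2 := by
    intro w
    rw [← hfilter, sum_filter]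
    refine sum_congr rfl fun b _ => ?_
    split_ifs <;> simp
  have hr := rowform_sq_le (f := lam) (c := c) (A₁ := ⌊A⌋₊) (A₂ := ⌊2 * A⌋₊) (B := B) wr
  have hi := rowform_sq_le (f := lam) (c := c) (A₁ := ⌊A⌋₊) (A₂ := ⌊2 * A⌋₊) (B := B) wi
  simp only [hwr, hwi] at hr hi
  simp_rw [hsum_ext] at hr hi
  rw [hsq_ext] at hr hi
  -- assemble `‖Mg‖² = Σ (re part)² + Σ (im part)² ≤ (Σ re² + Σ im²) √T = ‖g‖² √T`
  have hsplit : ∑ a ∈ Ioc ⌊A⌋₊ ⌊2 * A⌋₊, ‖∑ b ∈ Icc 1 N, g b * (entry c a b : ℂ)‖ ^ 2 =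
      ∑ a ∈ Ioc ⌊A⌋₊ ⌊2 * A⌋₊, (∑ b ∈ Icc 1 N, (g b).re * entry c a b) ^ 2 +
        ∑ a ∈ Ioc ⌊A⌋₊ ⌊2 * A⌋₊, (∑ b ∈ Icc 1 N, (g b).im * entry c a b) ^ 2 := by
    rw [← sum_add_distrib]
    exact sum_congr rfl fun a _ => norm_sq_sum_mul_ofReal g (entry c a) _
  have hg2 : ∑ b ∈ Icc 1 N, (g b).re ^ 2 + ∑ b ∈ Icc 1 N, (g b).im ^ 2 ≤ x / A := by
    rw [← sum_add_distrib]
    calc ∑ b ∈ Icc 1 N, ((g b).re ^ 2 + (g b).im ^ 2) = ∑ b ∈ Icc 1 N, ‖g b‖ ^ 2 := by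
          refine sum_congr rfl fun b _ => ?_
          rw [Complex.sq_norm, Complex.normSq_apply]; ring
      _ ≤ ∑ _b ∈ Icc 1 N, (1 : ℝ) := sum_le_sum fun b _ => pow_le_one₀ (norm_nonneg _) (hg b)
      _ = (N : ℝ) := by simp
      _ ≤ (B : ℝ) := by exact_mod_cast hNB
      _ ≤ x / A := Nat.floor_le (div_nonneg hx0 hApos.le)
  have hsqrtT : Real.sqrt (momentN lam c ⌊A⌋₊ ⌊2 * A⌋₊ B) ≤ x / Real.log x ^ C := by
    have hpow : Real.log x ^ (2 * C) = (Real.log x ^ C) ^ 2 := by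
      rw [mul_comm, Real.rpow_mul hL0, Real.rpow_two]
    calc Real.sqrt _ ≤ Real.sqrt (x ^ 2 / Real.log x ^ (2 * C)) := Real.sqrt_le_sqrt hT
      _ = x / Real.log x ^ C := by
          rw [hpow, ← div_pow, Real.sqrt_sq (div_nonneg hx0 (Real.rpow_nonneg hL0 C))]
  have hsqrt0 : 0 ≤ Real.sqrt (momentN lam c ⌊A⌋₊ ⌊2 * A⌋₊ B) := Real.sqrt_nonneg _
  rw [hsplit]
  calc ∑ a ∈ Ioc ⌊A⌋₊ ⌊2 * A⌋₊, (∑ b ∈ Icc 1 N, (g b).re * entry c a b) ^ 2 +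
        ∑ a ∈ Ioc ⌊A⌋₊ ⌊2 * A⌋₊, (∑ b ∈ Icc 1 N, (g b).im * entry c a b) ^ 2
      ≤ (∑ b ∈ Icc 1 N, (g b).re ^ 2) * Real.sqrt (momentN lam c ⌊A⌋₊ ⌊2 * A⌋₊ B) +
        (∑ b ∈ Icc 1 N, (g b).im ^ 2) * Real.sqrt (momentN lam c ⌊A⌋₊ ⌊2 * A⌋₊ B) :=
        add_le_add hr hi
    _ = (∑ b ∈ Icc 1 N, (g b).re ^ 2 + ∑ b ∈ Icc 1 N, (g b).im ^ 2) *
          Real.sqrt (momentN lam c ⌊A⌋₊ ⌊2 * A⌋₊ B) := by ring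
    _ ≤ (x / A) * (x / Real.log x ^ C) := mul_le_mul hg2 hsqrtT hsqrt0 (div_nonneg hx0 hApos.le)
    _ = x * (x / A) / Real.log x ^ C := by ring

/-- THE RESIDUAL WITHOUT "CM" IS THE CRUX. -/
theorem meanSquareBounded_iff : MeanSquareBounded ↔ LiouvilleShiftedTables.TableChowla :=
  ⟨tableChowla_of_meanSquareBounded, meanSquareBounded_of_tableChowla⟩

end

end Summit.Parity.GeneralizedHardyLittlewood.Theorems.TableChowla.Negative
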